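import Literature.Probability.RandomPlanarGeometry.HullUniformizer
import Literature.Probability.RandomPlanarGeometry.ConformalMapRiemannProofs
import HarnessLib

/-!
# Arc hulls on the unit circle via the Joukowski map ([LSW] Remark 3.7 / end of proof of Prop. 3.3)

G. F. Lawler, O. Schramm, W. Werner, *Conformal restriction: the chordal case*, J. Amer. Math.
Soc. **16** (2003) 917–955, arXiv:math/0209343 (**[LSW]**):

* Remark 3.7 (arXiv p. 13): "Let `A = {e^{iθ} : θ ∈ [0, π/2]}`. … one can calculate directly
  `Φ'_A(0) = 1/4`";
* end of the proof of Prop. 3.3 (arXiv p. 13): "let `A₊ = {e^{iθ} : θ ∈ [0, π/2 - ε]}`,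
  `A₋ = {e^{iθ} : θ ∈ [π/2 + ε, π]}` and `A = A₊ ∪ A₋`. … Note that `Φ_{A₊}'(0)` and `Φ_{A₋}'(0)`
  are bounded away from zero, but `lim_{ε ↘ 0} Φ_A'(0) = 0`."

We make these computations explicit and PROVE them. The Joukowski map `J(z) = z + 1/z` (the
tree's `Literature.Probability.RandomPlanarGeometry.joukowski` of `HullUniformizer`, used there on the lower half-disc) is a
conformal equivalence of `ℍ` onto the doubly slit plane `ℂ ∖ ((-∞, -2] ∪ [2, ∞))` mapping the
unit semicircle onto `(-2, 2)` by `e^{iθ} ↦ 2 cos θ`. Hence for `-2 ≤ p < q ≤ 2` the hull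
`circArcHull p q` (the points `e^{iθ}`, `θ ∈ [0, π]`, with `2 cos θ ∉ (p, q)`: two arcs of the unit
circle attached to `1` and `-1`) has the explicit restriction map

  `Φ_{p,q}(z) = a⁻¹ J⁻¹ (a J(z) + b)`, `a = 4/(q - p)`, `b = -2 - a p`,

(`joukowskiArcMap`), with `Φ'_{p,q}(0) = a⁻² = (q - p)² / 16` (`hasRestrictionDeriv_joukowskiArcMap`).
In particular `circArcHull p q ∈ 𝒬*` (`isStarHull_circArcHull`); the quarter arc
`{e^{iθ} : θ ∈ [π/2, π]} = circArcHull 0 2` has `Φ'(0) = 1/4` ([LSW] Rem. 3.7), and the symmetric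
pair of arcs `circArcHull (-s) s` (`s = 2 sin ε`) has `Φ'(0) = s²/4 → 0`.

## References

* [LSW] Remark 3.7 and the end of the proof of Prop. 3.3 (arXiv p. 13).
* G. F. Lawler, *Conformally Invariant Processes in the Plane* (2005), Example 3.38 (`z + 1/z`).
-/

noncomputable section

open Set Filter Topology Metric Complex Bornology Function
open UpperHalfPlane (upperHalfPlaneSet isOpen_upperHalfPlaneSet)
open scoped ComplexConjugate

namespace Literature.Probability.RandomPlanarGeometry

/-! ### The Joukowski map on the upper half-plane -/

/-- The **doubly slit plane** `ℂ ∖ ((-∞, p] ∪ [q, ∞))` (slits along the real axis): the points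
off the real axis or with real part in `(p, q)`. [folklore] -/
def slitCompl (p q : ℝ) : Set ℂ := {w | w.im ≠ 0 ∨ (p < w.re ∧ w.re < q)}

/-- Unfolding the tree's Joukowski map `joukowski` (`HullUniformizer`): `J(z) = z + z⁻¹`.
Lawler (2005), Example 3.38. [cite: Lawler2005, Example 3.38] -/
theorem joukowski_apply (z : ℂ) : joukowski z = z + z⁻¹ := rfl

/-- For `z ∈ ℍ`: `Im J(z) > 0 ↔ |z| > 1`. [folklore] -/
theorem joukowski_im_pos_iff {z : ℂ} (hz : z ∈ upperHalfPlaneSet) :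
    0 < (joukowski z).im ↔ 1 < ‖z‖ := by
  have hz' : 0 < z.im := hz
  have h0 : 0 < normSq z := normSq_pos.2 ((UpperHalfPlane.ne_zero ⟨_, hz⟩))
  rw [joukowski_im, mul_pos_iff_of_pos_left hz', sub_pos, inv_lt_one_iff₀]
  constructor
  · rintro (h | h)
    · exact absurd h (not_le.2 h0)
    · rw [normSq_eq_norm_sq] at h
      nlinarith [norm_nonneg z]
  · intro h
    right
    rw [normSq_eq_norm_sq]
    nlinarith

/-- For `z ∈ ℍ`: `Im J(z) < 0 ↔ |z| < 1`. [folklore] -/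
theorem joukowski_im_neg_iff {z : ℂ} (hz : z ∈ upperHalfPlaneSet) :
    (joukowski z).im < 0 ↔ ‖z‖ < 1 := by
  have hz' : 0 < z.im := hz
  have hz0 : z ≠ 0 := (UpperHalfPlane.ne_zero ⟨_, hz⟩)
  have h0 : 0 < normSq z := normSq_pos.2 hz0
  rw [joukowski_im, mul_neg_iff]
  constructor
  · rintro (⟨-, h⟩ | ⟨h, -⟩)
    · rw [sub_neg, one_lt_inv_iff₀] at h
      rw [normSq_eq_norm_sq] at h
      nlinarith [norm_nonneg z, norm_pos_iff.2 hz0]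
    · exact absurd h (not_lt.2 hz'.le)
  · intro h
    left
    refine ⟨hz', ?_⟩
    rw [sub_neg, one_lt_inv_iff₀, normSq_eq_norm_sq]
    exact ⟨h0.trans_eq (normSq_eq_norm_sq z), by nlinarith [norm_nonneg z]⟩

/-- For `z ∈ ℍ`: `Im J(z) = 0 ↔ |z| = 1`. [folklore] -/
theorem joukowski_im_eq_zero_iff {z : ℂ} (hz : z ∈ upperHalfPlaneSet) :
    (joukowski z).im = 0 ↔ ‖z‖ = 1 := by
  constructor
  · intro h
    rcases lt_trichotomy ‖z‖ 1 with h1 | h1 | h1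
    · exact absurd h ((joukowski_im_neg_iff hz).2 h1).ne
    · exact h1
    · exact absurd h ((joukowski_im_pos_iff hz).2 h1).ne'
  · intro h
    have hz' : 0 < z.im := hz
    rw [joukowski_im, normSq_eq_norm_sq, h]
    simp

/-- On the unit circle `J(z) = 2 Re z`. [folklore] -/
theorem joukowski_of_norm_eq_one {z : ℂ} (hz : ‖z‖ = 1) : joukowski z = 2 * (z.re : ℂ) := by
  have hinv : z⁻¹ = conj z := by
    rw [inv_def, normSq_eq_norm_sq, hz]
    simp
  rw [joukowski_apply, hinv]
  apply Complex.ext <;> simp [two_mul]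

/-- A point of `ℍ` on the unit circle has `|Re z| < 1`. [folklore] -/
theorem abs_re_lt_one {z : ℂ} (hz : z ∈ upperHalfPlaneSet) (h1 : ‖z‖ = 1) : |z.re| < 1 := by
  have hz' : 0 < z.im := hz
  have hsum : z.re ^ 2 + z.im ^ 2 = 1 := by
    have h := normSq_eq_norm_sq z
    rw [h1, normSq_apply] at h
    nlinarith
  rw [← sq_lt_one_iff_abs_lt_one]
  nlinarith

/-- `J` maps `ℍ` into the doubly slit plane `ℂ ∖ ((-∞, -2] ∪ [2, ∞))`. [folklore] -/
theorem mapsTo_joukowski_slitCompl : MapsTo joukowski upperHalfPlaneSet (slitCompl (-2) 2) := by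
  intro z hz
  by_cases h1 : ‖z‖ = 1
  · right
    have habs := abs_lt.1 (abs_re_lt_one hz h1)
    rw [joukowski_of_norm_eq_one h1]
    simp only [mul_re, re_ofNat, ofReal_re, im_ofNat, ofReal_im, mul_zero, sub_zero]
    constructor <;> linarith [habs.1, habs.2]
  · left
    exact fun h ↦ h1 ((joukowski_im_eq_zero_iff hz).1 h)

/-- **`J` is injective on `ℍ`**: `J a = J b` forces `a = b` or `a b = 1`, and `a b = 1` is
impossible for two points of `ℍ`. [folklore] -/
theorem injOn_joukowski_upperHalfPlaneSet : InjOn joukowski upperHalfPlaneSet := by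
  intro a ha b hb hab
  have ha0 : a ≠ 0 := (UpperHalfPlane.ne_zero ⟨_, ha⟩)
  have hb0 : b ≠ 0 := (UpperHalfPlane.ne_zero ⟨_, hb⟩)
  have h1 : a + a⁻¹ = b + b⁻¹ := hab
  have h2 : (a - b) * (a * b - 1) = 0 := by
    have h3 : (a - b) * (a * b - 1) = ((a + a⁻¹) - (b + b⁻¹)) * (a * b) := by
      field_simp
      ring
    rw [h3, h1, sub_self, zero_mul]
  rcases mul_eq_zero.1 h2 with h | h
  · exact sub_eq_zero.1 h
  · exfalso
    have hab1 : a * b = 1 := sub_eq_zero.1 h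
    have hb' : b = a⁻¹ := (eq_inv_of_mul_eq_one_right hab1)
    have hbi : 0 < b.im := hb
    rw [hb', inv_im] at hbi
    have hai : 0 < a.im := ha
    have : 0 < normSq a := normSq_pos.2 ha0
    have : -a.im / normSq a < 0 := div_neg_of_neg_of_pos (by linarith) this
    linarith

/-- For real `x ≠ 0`, `|x + 1/x| ≥ 2`. [folklore] -/
theorem two_le_abs_add_inv {x : ℝ} (hx : x ≠ 0) : 2 ≤ |x + x⁻¹| := by
  have h : x + x⁻¹ = (x ^ 2 + 1) / x := by field_simp
  have hpos : (0 : ℝ) < x ^ 2 + 1 := by positivity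
  rw [h, abs_div, le_div_iff₀ (abs_pos.2 hx), abs_of_pos hpos]
  nlinarith [sq_abs x, sq_nonneg (|x| - 1)]

/-- **`J` maps `ℍ` onto the doubly slit plane**: for `w` off the two slits, the roots of
`z² - w z + 1` have product `1`; the one in `ℍ` works (they cannot both be real, for then
`w = x + 1/x` would be real with `|w| ≥ 2`). [folklore] -/
theorem surjOn_joukowski_slitCompl : SurjOn joukowski upperHalfPlaneSet (slitCompl (-2) 2) := by
  intro w hw
  obtain ⟨r, hr⟩ : ∃ r : ℂ, r ^ 2 = w ^ 2 - 4 := ⟨(w ^ 2 - 4) ^ (1 / 2 : ℂ), by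
    rw [← cpow_nat_mul]; norm_num⟩
  set z₁ : ℂ := (w + r) / 2 with hz₁
  set z₂ : ℂ := (w - r) / 2 with hz₂
  have hprod : z₁ * z₂ = 1 := by
    rw [hz₁, hz₂]
    linear_combination (-1 / 4 : ℂ) * hr
  have hsum : z₁ + z₂ = w := by rw [hz₁, hz₂]; ring
  have hz₁0 : z₁ ≠ 0 := left_ne_zero_of_mul_eq_one hprod
  have hinv₁ : z₁⁻¹ = z₂ := (eq_inv_of_mul_eq_one_right hprod).symm
  have hinv₂ : z₂⁻¹ = z₁ := (eq_inv_of_mul_eq_one_left hprod).symm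
  have hJ₁ : joukowski z₁ = w := by rw [joukowski_apply, hinv₁, hsum]
  have hJ₂ : joukowski z₂ = w := by rw [joukowski_apply, hinv₂, add_comm, hsum]
  rcases lt_trichotomy z₁.im 0 with h | h | h
  · -- `z₂ = z₁⁻¹ ∈ ℍ`
    refine ⟨z₂, ?_, hJ₂⟩
    change 0 < z₂.im
    rw [← hinv₁, inv_im]
    exact div_pos (by linarith) (normSq_pos.2 hz₁0)
  · -- both roots real: contradiction
    exfalso
    set x : ℝ := z₁.re with hx
    have hz₁x : z₁ = x := Complex.ext (by simp [hx]) (by simp [h])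
    have hx0 : x ≠ 0 := by
      rintro h0
      rw [h0, ofReal_zero] at hz₁x
      exact hz₁0 hz₁x
    have hwx : w = ((x + x⁻¹ : ℝ) : ℂ) := by
      rw [← hJ₁, hz₁x, joukowski_apply]
      push_cast
      rfl
    have hwim : w.im = 0 := by rw [hwx, ofReal_im]
    have hwre : w.re = x + x⁻¹ := by rw [hwx, ofReal_re]
    rcases hw with hw | ⟨hw1, hw2⟩
    · exact hw hwim
    · have h2 := two_le_abs_add_inv hx0
      rw [← hwre] at h2
      have : |w.re| < 2 := abs_lt.2 ⟨by linarith, hw2⟩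
      linarith
  · exact ⟨z₁, h, hJ₁⟩

/-- `J` is a bijection of `ℍ` onto the doubly slit plane. [folklore] -/
theorem bijOn_joukowski_slitCompl : BijOn joukowski upperHalfPlaneSet (slitCompl (-2) 2) :=
  ⟨mapsTo_joukowski_slitCompl, injOn_joukowski_upperHalfPlaneSet, surjOn_joukowski_slitCompl⟩

/-- The image `J(ℍ)` is the doubly slit plane. [folklore] -/
theorem image_joukowski_upperHalfPlaneSet : joukowski '' upperHalfPlaneSet = slitCompl (-2) 2 :=
  bijOn_joukowski_slitCompl.image_eq

/-- `J` is holomorphic on `ℍ`. [folklore] -/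
theorem differentiableOn_joukowski_upperHalfPlaneSet : DifferentiableOn ℂ joukowski upperHalfPlaneSet :=
  fun _ hz ↦ (hasDerivAt_joukowski ((UpperHalfPlane.ne_zero ⟨_, hz⟩))).differentiableAt
    |>.differentiableWithinAt

/-- `J'(z) ≠ 0` on `ℍ` (`z² = 1` forces `z = ±1 ∉ ℍ`). [folklore] -/
theorem deriv_joukowski_ne_zero_of_mem {z : ℂ} (hz : z ∈ upperHalfPlaneSet) : deriv joukowski z ≠ 0 := by
  have hz0 := (UpperHalfPlane.ne_zero ⟨_, hz⟩)
  rw [(hasDerivAt_joukowski hz0).deriv]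
  intro h
  have h1 : z ^ 2 = 1 := by
    have h2 : (z ^ 2)⁻¹ = 1 := by linear_combination -h
    rw [← inv_inv (z ^ 2), h2, inv_one]
  have h3 : (z - 1) * (z + 1) = 0 := by linear_combination h1
  have hz' : 0 < z.im := hz
  rcases mul_eq_zero.1 h3 with h4 | h4
  · have := congrArg Complex.im (sub_eq_zero.1 h4); simp at this; linarith
  · have := congrArg Complex.im (add_eq_zero_iff_eq_neg.1 h4); simp at this; linarith

/-! ### The inverse `J⁻¹` on the doubly slit plane -/

/-- **`J⁻¹`, the `ℍ`-branch**: the inverse of `J` on `ℍ` (`Function.invFunOn`), a holomorphic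
bijection of the doubly slit plane `ℂ ∖ ((-∞, -2] ∪ [2, ∞))` onto `ℍ`. Not to be confused with
the tree's `Literature.Probability.RandomPlanarGeometry.jInv` (`JoukowskiEllipse`), the punctured-disc branch of `J⁻¹` onto `ℂ ∖ [-2, 2]`.
[folklore] -/
def joukowskiInv : ℂ → ℂ := invFunOn joukowski upperHalfPlaneSet

/-- `J⁻¹` maps the doubly slit plane into `ℍ`. [folklore] -/
theorem joukowskiInv_mem {w : ℂ} (hw : w ∈ slitCompl (-2) 2) : joukowskiInv w ∈ upperHalfPlaneSet :=
  bijOn_joukowski_slitCompl.surjOn.mapsTo_invFunOn hw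

/-- `J (J⁻¹ w) = w` on the doubly slit plane. [folklore] -/
@[simp] theorem joukowski_joukowskiInv {w : ℂ} (hw : w ∈ slitCompl (-2) 2) :
    joukowski (joukowskiInv w) = w :=
  bijOn_joukowski_slitCompl.invOn_invFunOn.2 hw

/-- `J⁻¹ (J z) = z` on `ℍ`. [folklore] -/
@[simp] theorem joukowskiInv_joukowski {z : ℂ} (hz : z ∈ upperHalfPlaneSet) :
    joukowskiInv (joukowski z) = z :=
  bijOn_joukowski_slitCompl.invOn_invFunOn.1 hz

/-- The doubly slit plane is open. [folklore] -/
theorem isOpen_slitCompl (p q : ℝ) : IsOpen (slitCompl p q) := by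
  have h1 : IsOpen {w : ℂ | w.im ≠ 0} := isOpen_ne_fun continuous_im continuous_const
  have h2 : IsOpen {w : ℂ | p < w.re ∧ w.re < q} :=
    (isOpen_lt continuous_const continuous_re).inter (isOpen_lt continuous_re continuous_const)
  exact h1.union h2

/-- **`J⁻¹` is holomorphic on the doubly slit plane** (holomorphic inverse function theorem,
`Complex.differentiableOn_invFunOn_image`). [folklore] -/
theorem differentiableOn_joukowskiInv : DifferentiableOn ℂ joukowskiInv (slitCompl (-2) 2) := by
  rw [← image_joukowski_upperHalfPlaneSet]
  exact Complex.differentiableOn_invFunOn_image isOpen_upperHalfPlaneSet differentiableOn_joukowski_upperHalfPlaneSet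
    injOn_joukowski_upperHalfPlaneSet fun z hz ↦ deriv_joukowski_ne_zero_of_mem hz

/-- `J⁻¹` has the strict derivative `(J' (J⁻¹ w))⁻¹ ≠ 0` at every point of the doubly slit
plane. [folklore] -/
theorem hasStrictDerivAt_joukowskiInv {w : ℂ} (hw : w ∈ slitCompl (-2) 2) :
    HasStrictDerivAt joukowskiInv (deriv joukowski (joukowskiInv w))⁻¹ w := by
  have h := Complex.hasStrictDerivAt_invFunOn isOpen_upperHalfPlaneSet differentiableOn_joukowski_upperHalfPlaneSet
    injOn_joukowski_upperHalfPlaneSet (fun z hz ↦ deriv_joukowski_ne_zero_of_mem hz) (joukowskiInv_mem hw)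
  rwa [joukowski_joukowskiInv hw] at h

/-- `|J⁻¹ w| < 1 ↔ Im w < 0`, `|J⁻¹ w| > 1 ↔ Im w > 0` on the doubly slit plane. [folklore] -/
theorem norm_joukowskiInv_lt_one_iff {w : ℂ} (hw : w ∈ slitCompl (-2) 2) :
    ‖joukowskiInv w‖ < 1 ↔ w.im < 0 := by
  rw [← joukowski_im_neg_iff (joukowskiInv_mem hw), joukowski_joukowskiInv hw]

/-- `|J⁻¹ w| > 1 ↔ Im w > 0` on the doubly slit plane. [folklore] -/
theorem one_lt_norm_joukowskiInv_iff {w : ℂ} (hw : w ∈ slitCompl (-2) 2) :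
    1 < ‖joukowskiInv w‖ ↔ 0 < w.im := by
  rw [← joukowski_im_pos_iff (joukowskiInv_mem hw), joukowski_joukowskiInv hw]

/-- `slitCompl` is monotone in the slits: `slitCompl p q ⊆ slitCompl p' q'` for `p' ≤ p`,
`q ≤ q'`. [folklore] -/
theorem slitCompl_mono {p q p' q' : ℝ} (hp : p' ≤ p) (hq : q ≤ q') : slitCompl p q ⊆ slitCompl p' q' := by
  rintro w (hw | ⟨hw1, hw2⟩)
  · exact Or.inl hw
  · exact Or.inr ⟨hp.trans_lt hw1, hw2.trans_le hq⟩

/-! ### The arc hulls `circArcHull p q` -/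

section ArcHull

variable {p q : ℝ}

/-- The part in `ℍ` of the arc hull: points `e^{iθ}`, `θ ∈ (0, π)`, with `2 cos θ ∉ (p, q)`.
[cite: LawlerSchrammWerner2003Restriction, Rem. 3.7 and Prop. 3.3 proof (p. 13)] -/
def circArcCore (p q : ℝ) : Set ℂ :=
  {z | z ∈ upperHalfPlaneSet ∧ ‖z‖ = 1 ∧ (2 * z.re ≤ p ∨ q ≤ 2 * z.re)}

/-- **The arc hull `circArcHull p q`** (`-2 ≤ p < q ≤ 2`): the closure of the set of points
`e^{iθ}`, `θ ∈ (0, π)`, of the unit circle with `2 cos θ ∉ (p, q)` — the union of the two closed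
arcs `{e^{iθ} : 2 cos θ ≥ q}` (attached to `1`) and `{e^{iθ} : 2 cos θ ≤ p}` (attached to `-1`),
either of which may be empty (`q = 2`, resp. `p = -2`). These are NOT smooth hulls in the sense
of the tree's `IsArcHull` (`HullApproximation`: `ℍ ∩ ∂A` an open Jordan arc with two real
endpoints) nor the `IsSlitHull.arcHull δ` of `ArcApproximation`: here the frontier in `ℍ` ends
at interior points, or has two components. [LSW]'s `A = {e^{iθ} : θ ∈ [0, π/2]}` of
Rem. 3.7 is (the mirror image of) `circArcHull 0 2`, and `A₊ ∪ A₋` of the proof of Prop. 3.3 (p. 13)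
is `circArcHull (-2 sin ε) (2 sin ε)`.
[cite: LawlerSchrammWerner2003Restriction, Rem. 3.7 and Prop. 3.3 proof (p. 13)] -/
def circArcHull (p q : ℝ) : Set ℂ := closure (circArcCore p q)

/-- The core lies in `ℍ`. [folklore] -/
theorem circArcCore_subset : circArcCore p q ⊆ upperHalfPlaneSet := fun _ hz ↦ hz.1

/-- The closed conditions defining the arcs. [folklore] -/
theorem isClosed_setOf_arc (p q : ℝ) :
    IsClosed {z : ℂ | ‖z‖ = 1 ∧ (2 * z.re ≤ p ∨ q ≤ 2 * z.re)} := by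
  refine (isClosed_eq continuous_norm continuous_const).inter (IsClosed.union ?_ ?_)
  · exact isClosed_le (continuous_const.mul continuous_re) continuous_const
  · exact isClosed_le continuous_const (continuous_const.mul continuous_re)

/-- Points of the arc hull lie on the unit circle, off the gap. [folklore] -/
theorem circArcHull_subset : circArcHull p q ⊆ {z : ℂ | ‖z‖ = 1 ∧ (2 * z.re ≤ p ∨ q ≤ 2 * z.re)} :=
  closure_minimal (fun _ hz ↦ hz.2) (isClosed_setOf_arc p q)

/-- Points of the arc hull have norm `1`. [folklore] -/
theorem norm_eq_one_of_mem_circArcHull {z : ℂ} (hz : z ∈ circArcHull p q) : ‖z‖ = 1 := (circArcHull_subset hz).1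

/-- `circArcHull p q ∩ ℍ = circArcCore p q`. [folklore] -/
theorem circArcHull_inter (p q : ℝ) : circArcHull p q ∩ upperHalfPlaneSet = circArcCore p q := by
  refine Subset.antisymm ?_ fun z hz ↦ ⟨subset_closure hz, hz.1⟩
  rintro z ⟨hz, hzH⟩
  exact ⟨hzH, circArcHull_subset hz⟩

/-- Membership in `ℍ ∖ circArcHull p q`: off the unit circle, or in the gap. [folklore] -/
theorem mem_diff_circArcHull_iff {z : ℂ} :
    z ∈ upperHalfPlaneSet \ circArcHull p q ↔
      z ∈ upperHalfPlaneSet ∧ (‖z‖ = 1 → p < 2 * z.re ∧ 2 * z.re < q) := by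
  constructor
  · rintro ⟨hzH, hzA⟩
    refine ⟨hzH, fun h1 ↦ ?_⟩
    by_contra hcon
    refine hzA (subset_closure ⟨hzH, h1, ?_⟩)
    rcases not_and_or.1 hcon with h | h
    · exact Or.inl (not_lt.1 h)
    · exact Or.inr (not_lt.1 h)
  · rintro ⟨hzH, h⟩
    refine ⟨hzH, fun hzA ↦ ?_⟩
    have hc : z ∈ circArcCore p q := by
      rw [← circArcHull_inter]
      exact ⟨hzA, hzH⟩
    obtain ⟨h1, h2⟩ := h hc.2.1
    rcases hc.2.2 with h3 | h3 <;> linarith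

/-- `ℍ ∖ circArcHull p q` is open. [folklore] -/
theorem isOpen_diff_circArcHull (p q : ℝ) : IsOpen (upperHalfPlaneSet \ circArcHull p q) :=
  isOpen_upperHalfPlaneSet.sdiff isClosed_closure

/-- For `z ∈ ℍ`: `J z ∈ slitCompl p q ↔` (`|z| = 1 → 2 Re z ∈ (p, q)`). [folklore] -/
theorem joukowski_mem_slitCompl_iff {z : ℂ} (hz : z ∈ upperHalfPlaneSet) :
    joukowski z ∈ slitCompl p q ↔ (‖z‖ = 1 → p < 2 * z.re ∧ 2 * z.re < q) := by
  by_cases h1 : ‖z‖ = 1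
  · rw [joukowski_of_norm_eq_one h1]
    simp only [slitCompl, mem_setOf_eq, h1, forall_const]
    simp
  · simp only [h1, IsEmpty.forall_iff, iff_true]
    exact Or.inl fun h ↦ h1 ((joukowski_im_eq_zero_iff hz).1 h)

/-- `J` maps `ℍ ∖ circArcHull p q` into `slitCompl p q`. [folklore] -/
theorem joukowski_mem_slitCompl {z : ℂ} (hz : z ∈ upperHalfPlaneSet \ circArcHull p q) :
    joukowski z ∈ slitCompl p q :=
  (joukowski_mem_slitCompl_iff hz.1).2 (mem_diff_circArcHull_iff.1 hz).2

/-! ### The explicit restriction map `Φ_{p,q} = a⁻¹ J⁻¹ (a J + b)` -/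

/-- The dilation factor `a = 4 / (q - p)`. [folklore] -/
def arcScale (p q : ℝ) : ℝ := 4 / (q - p)

/-- The shift `b = -2 - a p`. [folklore] -/
def arcShift (p q : ℝ) : ℝ := -2 - arcScale p q * p

/-- `a > 0`. [folklore] -/
theorem arcScale_pos (hpq : p < q) : 0 < arcScale p q := div_pos (by norm_num) (sub_pos.2 hpq)

/-- The affine map `w ↦ a w + b` sends `slitCompl p q` onto `slitCompl (-2) 2`:
`a p + b = -2`, `a q + b = 2`. [folklore] -/
theorem affine_mem_slitCompl_iff (hpq : p < q) {w : ℂ} :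
    (arcScale p q : ℂ) * w + arcShift p q ∈ slitCompl (-2) 2 ↔ w ∈ slitCompl p q := by
  have ha := arcScale_pos hpq
  have him : ((arcScale p q : ℂ) * w + arcShift p q).im = arcScale p q * w.im := by simp
  have hre : ((arcScale p q : ℂ) * w + arcShift p q).re = arcScale p q * (w.re - p) - 2 := by
    simp [arcShift]
    ring
  have h4 : arcScale p q * (q - p) = 4 := by
    rw [arcScale, div_mul_cancel₀ _ (sub_pos.2 hpq).ne']
  simp only [slitCompl, mem_setOf_eq, him, hre, mul_ne_zero_iff, ha.ne', ne_eq, not_false_eq_true,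
    true_and]
  apply or_congr Iff.rfl
  constructor
  · rintro ⟨h1, h2⟩
    constructor
    · nlinarith
    · nlinarith
  · rintro ⟨h1, h2⟩
    constructor
    · nlinarith
    · nlinarith

/-- **The map `Φ_{p,q}(z) = a⁻¹ J⁻¹ (a J(z) + b)`**, as a function.
[cite: LawlerSchrammWerner2003Restriction, Rem. 3.7 and Prop. 3.3 proof (p. 13)] -/
def joukowskiArcFun (p q : ℝ) (z : ℂ) : ℂ :=
  (arcScale p q : ℂ)⁻¹ * joukowskiInv (arcScale p q * joukowski z + arcShift p q)

/-- The inverse function `Ψ_{p,q}(w) = J⁻¹ (a⁻¹ (J(a w) - b))`. [folklore] -/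
def joukowskiArcInv (p q : ℝ) (w : ℂ) : ℂ :=
  joukowskiInv ((arcScale p q : ℂ)⁻¹ * (joukowski (arcScale p q * w) - arcShift p q))

/-- Multiplication by a positive real preserves `ℍ`. [folklore] -/
theorem ofReal_mul_mem {c : ℝ} (hc : 0 < c) {z : ℂ} (hz : z ∈ upperHalfPlaneSet) :
    (c : ℂ) * z ∈ upperHalfPlaneSet := by
  change 0 < ((c : ℂ) * z).im
  rw [im_ofReal_mul]
  exact mul_pos hc hz

/-- Division by a positive real preserves `ℍ`. [folklore] -/
theorem inv_ofReal_mul_mem {c : ℝ} (hc : 0 < c) {z : ℂ} (hz : z ∈ upperHalfPlaneSet) :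
    (c : ℂ)⁻¹ * z ∈ upperHalfPlaneSet := by
  rw [← ofReal_inv]
  exact ofReal_mul_mem (inv_pos.2 hc) hz

/-- `a J z + b ∈ slitCompl (-2) 2` for `z ∈ ℍ ∖ circArcHull p q`. [folklore] -/
theorem affine_joukowski_mem (hpq : p < q) {z : ℂ} (hz : z ∈ upperHalfPlaneSet \ circArcHull p q) :
    (arcScale p q : ℂ) * joukowski z + arcShift p q ∈ slitCompl (-2) 2 :=
  (affine_mem_slitCompl_iff hpq).2 (joukowski_mem_slitCompl hz)

/-- `Φ_{p,q}` maps `ℍ ∖ circArcHull p q` into `ℍ`. [folklore] -/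
theorem mapsTo_joukowskiArcFun (hpq : p < q) :
    MapsTo (joukowskiArcFun p q) (upperHalfPlaneSet \ circArcHull p q) upperHalfPlaneSet := fun _ hz ↦
  inv_ofReal_mul_mem (arcScale_pos hpq) (joukowskiInv_mem (affine_joukowski_mem hpq hz))

end ArcHull

section ArcMap

variable {p q : ℝ}

/-- `a ≠ 0` in `ℂ`. [folklore] -/
theorem arcScale_ne_zero (hpq : p < q) : (arcScale p q : ℂ) ≠ 0 := by
  exact_mod_cast (arcScale_pos hpq).ne'

/-- The argument of `J⁻¹` in `Ψ_{p,q}` corresponds under the affine map to `J(a w)`. [folklore] -/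
theorem affine_arcInvArg (hpq : p < q) (w : ℂ) :
    (arcScale p q : ℂ) * ((arcScale p q : ℂ)⁻¹ * (joukowski (arcScale p q * w) - arcShift p q)) +
      arcShift p q = joukowski (arcScale p q * w) := by
  have ha := arcScale_ne_zero hpq
  field_simp
  ring

/-- For `w ∈ ℍ` the argument of `J⁻¹` in `Ψ_{p,q}(w)` lies in `slitCompl p q`. [folklore] -/
theorem arcInvArg_mem (hpq : p < q) {w : ℂ} (hw : w ∈ upperHalfPlaneSet) :
    (arcScale p q : ℂ)⁻¹ * (joukowski (arcScale p q * w) - arcShift p q) ∈ slitCompl p q := by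
  rw [← affine_mem_slitCompl_iff hpq, affine_arcInvArg hpq]
  exact mapsTo_joukowski_slitCompl (ofReal_mul_mem (arcScale_pos hpq) hw)

/-- `Ψ_{p,q}` maps `ℍ` into `ℍ ∖ circArcHull p q`. [folklore] -/
theorem mapsTo_joukowskiArcInv (hp : -2 ≤ p) (hpq : p < q) (hq : q ≤ 2) :
    MapsTo (joukowskiArcInv p q) upperHalfPlaneSet (upperHalfPlaneSet \ circArcHull p q) := by
  intro w hw
  have hv := arcInvArg_mem hpq hw
  have hv' : _ ∈ slitCompl (-2) 2 := slitCompl_mono hp hq hv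
  refine mem_diff_circArcHull_iff.2 ⟨joukowskiInv_mem hv', fun h1 ↦ ?_⟩
  refine (joukowski_mem_slitCompl_iff (joukowskiInv_mem hv')).1 ?_ h1
  rw [joukowski_joukowskiInv hv']
  exact hv

/-- `Ψ_{p,q} ∘ Φ_{p,q} = id` on `ℍ ∖ circArcHull p q`. [folklore] -/
theorem leftInvOn_joukowskiArcFun (hpq : p < q) :
    LeftInvOn (joukowskiArcInv p q) (joukowskiArcFun p q) (upperHalfPlaneSet \ circArcHull p q) := by
  intro z hz
  have ha := arcScale_ne_zero hpq
  simp only [joukowskiArcFun, joukowskiArcInv]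
  rw [mul_inv_cancel_left₀ ha, joukowski_joukowskiInv (affine_joukowski_mem hpq hz)]
  have : (arcScale p q : ℂ)⁻¹ * ((arcScale p q : ℂ) * joukowski z + arcShift p q - arcShift p q) =
      joukowski z := by
    field_simp
    ring
  rw [this, joukowskiInv_joukowski hz.1]

/-- `Φ_{p,q} ∘ Ψ_{p,q} = id` on `ℍ`. [folklore] -/
theorem rightInvOn_joukowskiArcFun (hp : -2 ≤ p) (hpq : p < q) (hq : q ≤ 2) :
    RightInvOn (joukowskiArcInv p q) (joukowskiArcFun p q) upperHalfPlaneSet := by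
  intro w hw
  have ha := arcScale_ne_zero hpq
  have hv' : _ ∈ slitCompl (-2) 2 := slitCompl_mono hp hq (arcInvArg_mem hpq hw)
  simp only [joukowskiArcFun, joukowskiArcInv]
  rw [joukowski_joukowskiInv hv', affine_arcInvArg hpq,
    joukowskiInv_joukowski (ofReal_mul_mem (arcScale_pos hpq) hw), ← mul_assoc, inv_mul_cancel₀ ha,
    one_mul]

/-- **`Φ_{p,q}` is a bijection `ℍ ∖ circArcHull p q → ℍ`.** [folklore] -/
theorem bijOn_joukowskiArcFun (hp : -2 ≤ p) (hpq : p < q) (hq : q ≤ 2) :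
    BijOn (joukowskiArcFun p q) (upperHalfPlaneSet \ circArcHull p q) upperHalfPlaneSet :=
  InvOn.bijOn ⟨leftInvOn_joukowskiArcFun hpq, rightInvOn_joukowskiArcFun hp hpq hq⟩
    (mapsTo_joukowskiArcFun hpq) (mapsTo_joukowskiArcInv hp hpq hq)

/-- The derivative of `Φ_{p,q}` (chain rule through `J`, the affine map and `J⁻¹`). [folklore] -/
theorem hasDerivAt_joukowskiArcFun (hpq : p < q) {z : ℂ} (hz : z ∈ upperHalfPlaneSet \ circArcHull p q) :
    HasDerivAt (joukowskiArcFun p q)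
      ((arcScale p q : ℂ)⁻¹ *
        ((deriv joukowski (joukowskiInv (arcScale p q * joukowski z + arcShift p q)))⁻¹ *
          ((arcScale p q : ℂ) * deriv joukowski z))) z := by
  have hz0 := (UpperHalfPlane.ne_zero ⟨_, hz.1⟩)
  have hJ : HasDerivAt joukowski (deriv joukowski z) z :=
    (hasDerivAt_joukowski hz0).differentiableAt.hasDerivAt
  have haff : HasDerivAt (fun y ↦ (arcScale p q : ℂ) * joukowski y + arcShift p q)
      ((arcScale p q : ℂ) * deriv joukowski z) z := by
    simpa using (hJ.const_mul (arcScale p q : ℂ)).add_const (arcShift p q : ℂ)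
  have hinv := (hasStrictDerivAt_joukowskiInv (affine_joukowski_mem hpq hz)).hasDerivAt
  exact (hinv.comp z haff).const_mul _

/-- `Φ_{p,q}` is holomorphic on `ℍ ∖ circArcHull p q`. [folklore] -/
theorem differentiableOn_joukowskiArcFun (hpq : p < q) :
    DifferentiableOn ℂ (joukowskiArcFun p q) (upperHalfPlaneSet \ circArcHull p q) := fun _ hz ↦
  (hasDerivAt_joukowskiArcFun hpq hz).differentiableAt.differentiableWithinAt

/-- `Φ'_{p,q} ≠ 0` on `ℍ ∖ circArcHull p q`. [folklore] -/
theorem deriv_joukowskiArcFun_ne_zero (hpq : p < q) {z : ℂ} (hz : z ∈ upperHalfPlaneSet \ circArcHull p q) :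
    deriv (joukowskiArcFun p q) z ≠ 0 := by
  rw [(hasDerivAt_joukowskiArcFun hpq hz).deriv]
  refine mul_ne_zero (inv_ne_zero (arcScale_ne_zero hpq)) (mul_ne_zero (inv_ne_zero ?_)
    (mul_ne_zero (arcScale_ne_zero hpq) (deriv_joukowski_ne_zero_of_mem hz.1)))
  exact deriv_joukowski_ne_zero_of_mem (joukowskiInv_mem (affine_joukowski_mem hpq hz))

/-- The inverse of `Φ_{p,q}` (as `Function.invFunOn`) is holomorphic on `ℍ`. [folklore] -/
theorem differentiableOn_invFunOn_joukowskiArcFun (hp : -2 ≤ p) (hpq : p < q) (hq : q ≤ 2) :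
    DifferentiableOn ℂ (invFunOn (joukowskiArcFun p q) (upperHalfPlaneSet \ circArcHull p q))
      upperHalfPlaneSet := by
  have h := Complex.differentiableOn_invFunOn_image (isOpen_diff_circArcHull p q)
    (differentiableOn_joukowskiArcFun hpq) (bijOn_joukowskiArcFun hp hpq hq).injOn
    fun z hz ↦ deriv_joukowskiArcFun_ne_zero hpq hz
  rwa [(bijOn_joukowskiArcFun hp hpq hq).image_eq] at h

/-- **The restriction map `Φ_{p,q}` of the arc hull**, bundled as a conformal equivalence
`ℍ ∖ circArcHull p q → ℍ`. [cite: LawlerSchrammWerner2003Restriction, Rem. 3.7 and Prop. 3.3 proof (p. 13)] -/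
def joukowskiArcMap (hp : -2 ≤ p) (hpq : p < q) (hq : q ≤ 2) :
    ConformalEquiv (upperHalfPlaneSet \ circArcHull p q) upperHalfPlaneSet :=
  ConformalEquiv.ofBijOn (joukowskiArcFun p q) (differentiableOn_joukowskiArcFun hpq)
    (bijOn_joukowskiArcFun hp hpq hq) (differentiableOn_invFunOn_joukowskiArcFun hp hpq hq)

/-- `joukowskiArcMap` acts as `joukowskiArcFun`. [folklore] -/
@[simp] theorem joukowskiArcMap_apply (hp : -2 ≤ p) (hpq : p < q) (hq : q ≤ 2) (z : ℂ) :
    joukowskiArcMap hp hpq hq z = joukowskiArcFun p q z := rfl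

/-- **`circArcHull p q ∈ 𝒬*`**: bounded, the closure of its part in `ℍ`, with `ℍ ∖ circArcHull p q ≅ ℍ`
simply connected, and `0 ∉ circArcHull p q`. [cite: LawlerSchrammWerner2003Restriction, Rem. 3.7 and Prop. 3.3 proof (p. 13)] -/
theorem isStarHull_circArcHull (hp : -2 ≤ p) (hpq : p < q) (hq : q ≤ 2) : IsStarHull (circArcHull p q) := by
  refine ⟨⟨?_, ?_, ?_⟩, fun h0 ↦ ?_⟩
  · exact (isBounded_closedBall (x := (0 : ℂ)) (r := 1)).subset fun z hz ↦ by
      simpa using (norm_eq_one_of_mem_circArcHull hz).le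
  · rw [circArcHull_inter, circArcHull]
  · exact (joukowskiArcMap hp hpq hq).isSimplyConnected_iff.2 isSimplyConnected_upperHalfPlaneSet
  · have := norm_eq_one_of_mem_circArcHull h0
    simp at this

/-! ### Boundary behaviour of `Φ_{p,q}`: restriction map, `Φ'_{p,q}(0) = (q - p)²/16` -/

/-- The inner branch `u(z) = J⁻¹(a J(z) + b)` of `Φ_{p,q} = a⁻¹ u`. [folklore] -/
def arcInner (p q : ℝ) (z : ℂ) : ℂ := joukowskiInv (arcScale p q * joukowski z + arcShift p q)

/-- `Φ_{p,q} = a⁻¹ u`. [folklore] -/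
theorem joukowskiArcFun_eq (z : ℂ) : joukowskiArcFun p q z = (arcScale p q : ℂ)⁻¹ * arcInner p q z := rfl

/-- `J (u z) = a J z + b`. [folklore] -/
theorem joukowski_arcInner (hpq : p < q) {z : ℂ} (hz : z ∈ upperHalfPlaneSet \ circArcHull p q) :
    joukowski (arcInner p q z) = arcScale p q * joukowski z + arcShift p q :=
  joukowski_joukowskiInv (affine_joukowski_mem hpq hz)

/-- `u z ∈ ℍ`, in particular `u z ≠ 0`. [folklore] -/
theorem arcInner_mem (hpq : p < q) {z : ℂ} (hz : z ∈ upperHalfPlaneSet \ circArcHull p q) :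
    arcInner p q z ∈ upperHalfPlaneSet :=
  joukowskiInv_mem (affine_joukowski_mem hpq hz)

/-- Inside the unit disc `|u z| < 1`. [folklore] -/
theorem norm_arcInner_lt_one (hpq : p < q) {z : ℂ} (hz : z ∈ upperHalfPlaneSet \ circArcHull p q)
    (hz1 : ‖z‖ < 1) : ‖arcInner p q z‖ < 1 := by
  rw [arcInner, norm_joukowskiInv_lt_one_iff (affine_joukowski_mem hpq hz)]
  have him : ((arcScale p q : ℂ) * joukowski z + arcShift p q).im = arcScale p q * (joukowski z).im := by
    simp
  rw [him]
  exact mul_neg_of_pos_of_neg (arcScale_pos hpq) ((joukowski_im_neg_iff hz.1).2 hz1)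

/-- Outside the unit disc `|u z| > 1`. [folklore] -/
theorem one_lt_norm_arcInner (hpq : p < q) {z : ℂ} (hz : z ∈ upperHalfPlaneSet \ circArcHull p q)
    (hz1 : 1 < ‖z‖) : 1 < ‖arcInner p q z‖ := by
  rw [arcInner, one_lt_norm_joukowskiInv_iff (affine_joukowski_mem hpq hz)]
  have him : ((arcScale p q : ℂ) * joukowski z + arcShift p q).im = arcScale p q * (joukowski z).im := by
    simp
  rw [him]
  exact mul_pos (arcScale_pos hpq) ((joukowski_im_pos_iff hz.1).2 hz1)

/-- **The functional equation, solved for `u`**: `u = a z + a z⁻¹ + b - u⁻¹`. [folklore] -/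
theorem arcInner_eq (hpq : p < q) {z : ℂ} (hz : z ∈ upperHalfPlaneSet \ circArcHull p q) :
    arcInner p q z = arcScale p q * z + arcScale p q * z⁻¹ + arcShift p q - (arcInner p q z)⁻¹ := by
  have h := joukowski_arcInner hpq hz
  simp only [joukowski_apply] at h
  linear_combination h

/-- **The functional equation near `0`**: `u · (a z² + b z + a - u z) = z`. [folklore] -/
theorem arcInner_mul_eq (hpq : p < q) {z : ℂ} (hz : z ∈ upperHalfPlaneSet \ circArcHull p q) :
    arcInner p q z * ((arcScale p q : ℂ) * z ^ 2 + arcShift p q * z + arcScale p q - arcInner p q z * z) = z := by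
  have hz0 := (UpperHalfPlane.ne_zero ⟨_, hz.1⟩)
  have hu0 := (UpperHalfPlane.ne_zero ⟨_, (arcInner_mem hpq hz)⟩)
  have h := arcInner_eq hpq hz
  -- multiply `u = a z + a/z + b - 1/u` by `u z`
  have h2 : arcInner p q z * (arcInner p q z * z) =
      (arcScale p q * z + arcScale p q * z⁻¹ + arcShift p q - (arcInner p q z)⁻¹) * (arcInner p q z * z) := by
    rw [← h]
  have h3 : (arcScale p q * z + arcScale p q * z⁻¹ + arcShift p q - (arcInner p q z)⁻¹) *
      (arcInner p q z * z) =
      arcInner p q z * (arcScale p q * z ^ 2 + arcShift p q * z + arcScale p q) - z := by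
    field_simp
    ring
  linear_combination -h2 - h3

/-- **`Φ_{p,q}` is a restriction map of `circArcHull p q`** (boundary value `0` at `0`: near `0`
the inner branch `u` stays in the unit disc, so `u = z/(a z² + b z + a - u z) → 0`; at `∞`,
`|u| > 1` and `u/z = a + a/z² + b/z - 1/(uz) → a`).
[cite: LawlerSchrammWerner2003Restriction, Rem. 3.7 and Prop. 3.3 proof (p. 13)] -/
theorem isRestrictionMap_joukowskiArcMap (hp : -2 ≤ p) (hpq : p < q) (hq : q ≤ 2) :
    IsRestrictionMap (circArcHull p q) (joukowskiArcMap hp hpq hq) := by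
  set U := upperHalfPlaneSet \ circArcHull p q with hU
  have ha := arcScale_ne_zero hpq
  -- the denominator `D z = a z² + b z + a - u z · z` tends to `a` as `z → 0` within `U`
  have hsmall : ∀ᶠ z in 𝓝[U] 0, z ∈ U ∧ ‖z‖ < 1 := by
    filter_upwards [self_mem_nhdsWithin, nhdsWithin_le_nhds (ball_mem_nhds (0 : ℂ) one_pos)]
      with z hz hz1
    exact ⟨hz, by simpa using hz1⟩
  have hT1 : Tendsto (fun z ↦ arcInner p q z * z) (𝓝[U] 0) (𝓝 0) := by
    refine squeeze_zero_norm' ?_ ((tendsto_norm_zero).mono_left nhdsWithin_le_nhds)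
    filter_upwards [hsmall] with z ⟨hz, hz1⟩
    rw [norm_mul]
    calc ‖arcInner p q z‖ * ‖z‖ ≤ 1 * ‖z‖ := by
          gcongr
          exact (norm_arcInner_lt_one hpq hz hz1).le
      _ = ‖z‖ := one_mul _
  set D : ℂ → ℂ := fun z ↦ (arcScale p q : ℂ) * z ^ 2 + arcShift p q * z + arcScale p q -
    arcInner p q z * z with hD
  have hDt : Tendsto D (𝓝[U] 0) (𝓝 (arcScale p q)) := by
    have h1 : Tendsto (fun z : ℂ ↦ (arcScale p q : ℂ) * z ^ 2 + arcShift p q * z + arcScale p q) (𝓝[U] 0)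
        (𝓝 ((arcScale p q : ℂ) * 0 ^ 2 + arcShift p q * 0 + arcScale p q)) :=
      (Continuous.tendsto (by fun_prop) 0).mono_left nhdsWithin_le_nhds
    have h2 := h1.sub hT1
    simp only [ne_eq, OfNat.ofNat_ne_zero, not_false_eq_true, zero_pow, mul_zero, zero_add,
      sub_zero] at h2
    exact h2
  have hDne : ∀ z ∈ U, D z ≠ 0 := fun z hz hD0 ↦ by
    have h := arcInner_mul_eq hpq hz
    rw [show (arcScale p q : ℂ) * z ^ 2 + arcShift p q * z + arcScale p q - arcInner p q z * z = D z
      from rfl, hD0, mul_zero] at h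
    exact (UpperHalfPlane.ne_zero ⟨_, hz.1⟩) h.symm
  have hueq : ∀ z ∈ U, arcInner p q z = z / D z := fun z hz ↦ by
    rw [eq_div_iff (hDne z hz)]
    exact arcInner_mul_eq hpq hz
  refine ⟨?_, ?_⟩
  · -- boundary value `0` at `0`
    change Tendsto (fun z ↦ joukowskiArcFun p q z) (𝓝[U] 0) (𝓝 0)
    have h1 : Tendsto (fun z : ℂ ↦ (arcScale p q : ℂ)⁻¹ * (z / D z)) (𝓝[U] 0)
        (𝓝 ((arcScale p q : ℂ)⁻¹ * (0 / arcScale p q))) :=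
      ((tendsto_id.mono_left nhdsWithin_le_nhds).div hDt ha).const_mul _
    rw [zero_div, mul_zero] at h1
    refine h1.congr' ?_
    filter_upwards [self_mem_nhdsWithin] with z hz
    rw [joukowskiArcFun_eq, hueq z hz]
  · -- `Φ z / z → 1` at `∞`
    change Tendsto (fun z ↦ joukowskiArcFun p q z / z) (cocompact ℂ ⊓ 𝓟 U) (𝓝 1)
    have hlarge : ∀ᶠ z in cocompact ℂ ⊓ 𝓟 U, z ∈ U ∧ 1 < ‖z‖ := by
      have h1 : ∀ᶠ z : ℂ in cocompact ℂ, 1 < ‖z‖ := by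
        have := (isCompact_closedBall (0 : ℂ) 1).compl_mem_cocompact
        filter_upwards [this] with z hz
        simpa using hz
      filter_upwards [mem_inf_of_right (mem_principal_self U), mem_inf_of_left h1] with z hz hz1
      exact ⟨hz, hz1⟩
    have hinv : Tendsto (fun z : ℂ ↦ z⁻¹) (cocompact ℂ ⊓ 𝓟 U) (𝓝 0) := by
      refine Tendsto.mono_left ?_ inf_le_left
      rw [← cobounded_eq_cocompact]
      exact tendsto_inv₀_cobounded
    have hT2 : Tendsto (fun z ↦ (arcInner p q z)⁻¹ * z⁻¹) (cocompact ℂ ⊓ 𝓟 U) (𝓝 0) := by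
      refine squeeze_zero_norm' ?_ (tendsto_zero_iff_norm_tendsto_zero.1 hinv)
      filter_upwards [hlarge] with z ⟨hz, hz1⟩
      rw [norm_mul, norm_inv]
      calc ‖arcInner p q z‖⁻¹ * ‖z⁻¹‖ ≤ 1 * ‖z⁻¹‖ := by
            gcongr
            exact inv_le_one_of_one_le₀ (one_lt_norm_arcInner hpq hz hz1).le
        _ = ‖z⁻¹‖ := one_mul _
    have hone : Tendsto (fun z : ℂ ↦ z * z⁻¹) (cocompact ℂ ⊓ 𝓟 U) (𝓝 1) := by
      refine tendsto_const_nhds.congr' ?_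
      filter_upwards [hlarge] with z ⟨hz, _⟩
      exact (mul_inv_cancel₀ ((UpperHalfPlane.ne_zero ⟨_, hz.1⟩))).symm
    have h3 : Tendsto (fun z : ℂ ↦ (arcScale p q : ℂ) * (z * z⁻¹) + arcScale p q * z⁻¹ * z⁻¹ +
        arcShift p q * z⁻¹ - (arcInner p q z)⁻¹ * z⁻¹) (cocompact ℂ ⊓ 𝓟 U)
        (𝓝 ((arcScale p q : ℂ) * 1 + arcScale p q * 0 * 0 + arcShift p q * 0 - 0)) :=
      (((hone.const_mul _).add ((hinv.const_mul _).mul hinv)).add (hinv.const_mul _)).sub hT2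
    simp only [mul_one, mul_zero, add_zero, sub_zero] at h3
    have h4 := h3.const_mul (arcScale p q : ℂ)⁻¹
    rw [inv_mul_cancel₀ ha] at h4
    refine h4.congr' ?_
    filter_upwards [hlarge] with z ⟨hz, _⟩
    rw [joukowskiArcFun_eq, mul_div_assoc, div_eq_mul_inv (arcInner p q z) z]
    congr 1
    conv_rhs => rw [arcInner_eq hpq hz]
    ring

/-- **`Φ'_{p,q}(0) = a⁻² = (q - p)² / 16`** ([LSW] Rem. 3.7: `Φ'_A(0) = 1/4` for the quarter
arc, `p = 0`, `q = 2`; proof of Prop. 3.3, p. 13: `Φ'_A(0) → 0` for the symmetric pair of arcs,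
`q = -p = 2 sin ε → 0`). [cite: LawlerSchrammWerner2003Restriction, Rem. 3.7 and Prop. 3.3 proof (p. 13)] -/
theorem hasRestrictionDeriv_joukowskiArcMap (hp : -2 ≤ p) (hpq : p < q) (hq : q ≤ 2) :
    HasRestrictionDeriv (circArcHull p q) (joukowskiArcMap hp hpq hq) (((q - p) / 4) ^ 2) := by
  set U := upperHalfPlaneSet \ circArcHull p q with hU
  have ha := arcScale_ne_zero hpq
  change Tendsto (fun z ↦ joukowskiArcFun p q z / z) (𝓝[U] 0) (𝓝 (((((q - p) / 4) ^ 2 : ℝ)) : ℂ))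
  -- as in `isRestrictionMap_joukowskiArcMap`: `Φ z / z = a⁻¹ / D z → a⁻¹ / a`
  have hsmall : ∀ᶠ z in 𝓝[U] 0, z ∈ U ∧ ‖z‖ < 1 := by
    filter_upwards [self_mem_nhdsWithin, nhdsWithin_le_nhds (ball_mem_nhds (0 : ℂ) one_pos)]
      with z hz hz1
    exact ⟨hz, by simpa using hz1⟩
  have hT1 : Tendsto (fun z ↦ arcInner p q z * z) (𝓝[U] 0) (𝓝 0) := by
    refine squeeze_zero_norm' ?_ ((tendsto_norm_zero).mono_left nhdsWithin_le_nhds)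
    filter_upwards [hsmall] with z ⟨hz, hz1⟩
    rw [norm_mul]
    calc ‖arcInner p q z‖ * ‖z‖ ≤ 1 * ‖z‖ := by
          gcongr
          exact (norm_arcInner_lt_one hpq hz hz1).le
      _ = ‖z‖ := one_mul _
  set D : ℂ → ℂ := fun z ↦ (arcScale p q : ℂ) * z ^ 2 + arcShift p q * z + arcScale p q -
    arcInner p q z * z with hD
  have hDt : Tendsto D (𝓝[U] 0) (𝓝 (arcScale p q)) := by
    have h1 : Tendsto (fun z : ℂ ↦ (arcScale p q : ℂ) * z ^ 2 + arcShift p q * z + arcScale p q) (𝓝[U] 0)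
        (𝓝 ((arcScale p q : ℂ) * 0 ^ 2 + arcShift p q * 0 + arcScale p q)) :=
      (Continuous.tendsto (by fun_prop) 0).mono_left nhdsWithin_le_nhds
    have h2 := h1.sub hT1
    simp only [ne_eq, OfNat.ofNat_ne_zero, not_false_eq_true, zero_pow, mul_zero, zero_add,
      sub_zero] at h2
    exact h2
  have hDne : ∀ z ∈ U, D z ≠ 0 := fun z hz hD0 ↦ by
    have h := arcInner_mul_eq hpq hz
    rw [show (arcScale p q : ℂ) * z ^ 2 + arcShift p q * z + arcScale p q - arcInner p q z * z = D z
      from rfl, hD0, mul_zero] at h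
    exact (UpperHalfPlane.ne_zero ⟨_, hz.1⟩) h.symm
  have h1 : Tendsto (fun z ↦ (arcScale p q : ℂ)⁻¹ / D z) (𝓝[U] 0)
      (𝓝 ((arcScale p q : ℂ)⁻¹ / arcScale p q)) := tendsto_const_nhds.div hDt ha
  have hval : (arcScale p q : ℂ)⁻¹ / arcScale p q = (((((q - p) / 4) ^ 2 : ℝ)) : ℂ) := by
    have hqp : ((q : ℂ) - p) ≠ 0 := by
      have : (q - p : ℝ) ≠ 0 := (sub_pos.2 hpq).ne'
      exact_mod_cast this
    simp only [arcScale]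
    push_cast
    field_simp
  rw [hval] at h1
  refine h1.congr' ?_
  filter_upwards [self_mem_nhdsWithin] with z hz
  have hz0 := (UpperHalfPlane.ne_zero ⟨_, hz.1⟩)
  have hu : arcInner p q z = z / D z := by
    rw [eq_div_iff (hDne z hz)]
    exact arcInner_mul_eq hpq hz
  rw [joukowskiArcFun_eq, hu, mul_div_assoc, div_div, mul_comm (D z) z, ← div_div, div_self hz0,
    one_div, div_eq_mul_inv]

/-- The value `Φ'_{p,q}(0) = ((q - p)/4)²` of `hasRestrictionDeriv_joukowskiArcMap` is positive
(`p < q`). [folklore] -/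
theorem circArcDeriv_pos (hpq : p < q) : 0 < ((q - p) / 4) ^ 2 := by
  have := sub_pos.2 hpq
  positivity

/-- The value `Φ'_{p,q}(0) = ((q - p)/4)²` of `hasRestrictionDeriv_joukowskiArcMap` is at most `1`
(`-2 ≤ p < q ≤ 2`; [LSW] (2.4) `Φ'_A(0) ≤ 1` for these hulls), with equality only for the
empty hull `p = -2`, `q = 2`. [cite: LawlerSchrammWerner2003Restriction, §2 (2.4) p. 7] -/
theorem circArcDeriv_le_one (hp : -2 ≤ p) (hpq : p < q) (hq : q ≤ 2) : ((q - p) / 4) ^ 2 ≤ 1 := by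
  have h1 : 0 ≤ (q - p) / 4 := by linarith
  have h2 : (q - p) / 4 ≤ 1 := by linarith
  nlinarith

end ArcMap

end Literature.Probability.RandomPlanarGeometry

end
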